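import Summits.CriticalPhenomena.SAWScalingLimit.Theorems.AvoidanceLimit.Negative.AvoidanceLimitWitnessDomains

/-!
# Negative knowledge on crux `AvoidanceLimit`, part 5: the marked-point clauses are decorative

Support file (refuter / cdisprove lane) for the crux
`Summit.CriticalPhenomena.SAWScalingLimit.Theses.SAWLoopFugacityFlow.AvoidanceLimit`
(stmt-CriticalPhenomena-10649, route SAWLoopFugacityFlow, rank 2): for every Dobrushin domain
`(D; a, b)`, hull subdomain `D'`, endpoint approximation, chordal uniformizer `φ`, pulled-back hull
`A = closure (ℍ ∖ φ⁻¹ D')` and restriction data `(Φ, d = Φ'_A(0))`,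
`P_δ(range γ_δ ⊆ closure D') → d^(5/8)` as `δ → 0+`. The crux itself is NOT refuted (it follows from
`SAWScalingLimit`; LSW04 Prediction 1 on avoidance marginals); the `Negative/` files record, as
kernel-checked theorems, which hypotheses any proof MUST use: each variant is the crux with ONE
hypothesis dropped or weakened, everything else verbatim, and each is FALSE.

By contrast with parts 2–4, the clauses `D'.pt 0 = D.pt 0`, `D'.pt 1 = D.pt 1` carry NO information:
**`avoidanceLimitWithoutPt_of`** — the crux implies its variant without them (the converse is
trivial), because the conclusion sees `D'` only through its carrier and the ball agreement already
puts `a, b` on `∂D'` (`pt_mem_frontier_of_ball_agree`), so `D'` can be re-marked at `a, b`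
(`exists_dobrushin_remark`: shift the boundary loop). Information for provers: `hpt` cannot be used
for anything; information for planners: it may be dropped from the statement. [folklore]
-/

noncomputable section

open Set Filter Topology MeasureTheory Complex Metric
open UpperHalfPlane (upperHalfPlaneSet isOpen_upperHalfPlaneSet)
open Literature.Probability.RandomPlanarGeometry Literature.Probability.LatticeModels
open Summit.CriticalPhenomena.SAWScalingLimit.Theses.SAWLoopFugacityFlow (AvoidanceLimit)

namespace Summit.CriticalPhenomena.SAWScalingLimit.Theorems.AvoidanceLimit.Negative

/-! ### (c) A decorative hypothesis: agreement of the marked points -/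

/-- The crux with the two clauses `D'.pt 0 = D.pt 0`, `D'.pt 1 = D.pt 1` DROPPED. This is NOT a
genuine strengthening: it is EQUIVALENT to the crux (`avoidanceLimitWithoutPt_of` and the
trivial converse), because the
conclusion sees `D'` only through its carrier and the ball agreement already puts `a, b` on `∂D'`,
so `D'` can be re-marked at `a, b`. Information for provers: `hpt` cannot be used for anything. -/
def AvoidanceLimitWithoutPt : Prop :=
  ∀ (D D' : DobrushinDomain) (a b : ℝ → Site 2), SAW.IsEndpointApprox D a b →
    D'.carrier ⊆ D.carrier →
    (∃ ε : ℝ, 0 < ε ∧ D'.carrier ∩ Metric.ball (D.pt 0) ε = D.carrier ∩ Metric.ball (D.pt 0) ε ∧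
      D'.carrier ∩ Metric.ball (D.pt 1) ε = D.carrier ∩ Metric.ball (D.pt 1) ε) →
    ∀ (φ : ConformalEquiv upperHalfPlaneSet D.carrier), D.IsChordalUniformizing φ →
    ∀ (A : Set ℂ), A = closure (upperHalfPlaneSet \ {z | z ∈ upperHalfPlaneSet ∧ φ z ∈ D'.carrier}) →
    ∀ (Φ : ConformalEquiv (upperHalfPlaneSet \ A) upperHalfPlaneSet) (d : ℝ),
      IsRestrictionMap A Φ → HasRestrictionDeriv A Φ d →
      Tendsto (fun δ => ((SAW.law D.carrier δ (a δ) (b δ)).map (fun γ => γ.curve))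
        (CurveClass.rangeSubset (closure D'.carrier))) (𝓝[>] 0)
        (𝓝 (ENNReal.ofReal (d ^ ((5 : ℝ) / 8))))

/-- Shifting a simple `1`-periodic loop keeps it injective on a period (cf. `ArcHullDomains`). [folklore] -/
theorem injOn_shift' {X : Type*} {g : ℝ → X} (hp : Function.Periodic g 1)
    (hinj : InjOn g (Ico 0 1)) (c : ℝ) : InjOn (fun t ↦ g (t + c)) (Ico 0 1) := by
  have hfr : ∀ x, g (Int.fract x) = g x := fun x ↦ by
    rw [Int.fract]
    have := hp.sub_int_mul_eq (x := x) ⌊x⌋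
    rwa [mul_one] at this
  intro s hs t ht hst
  simp only at hst
  rw [← hfr (s + c), ← hfr (t + c)] at hst
  have h1 := hinj ⟨Int.fract_nonneg _, Int.fract_lt_one _⟩ ⟨Int.fract_nonneg _, Int.fract_lt_one _⟩ hst
  obtain ⟨z, hz⟩ := Int.fract_eq_fract.1 h1
  have hz' : (s - t : ℝ) = z := by linarith
  have habs : |(z : ℝ)| < 1 := by
    rw [← hz', abs_sub_lt_iff]
    exact ⟨by linarith [hs.1, hs.2, ht.1, ht.2], by linarith [hs.1, hs.2, ht.1, ht.2]⟩
  have hz0 : z = 0 := by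
    have : |z| < 1 := by exact_mod_cast habs
    exact Int.abs_lt_one_iff.1 this
  rw [hz0, Int.cast_zero, sub_eq_zero] at hz'
  exact hz'

/-- Shifting the parameter does not change the range. [folklore] -/
theorem range_shift' {X : Type*} (g : ℝ → X) (c : ℝ) : range (fun t ↦ g (t + c)) = range g := by
  ext x
  constructor
  · rintro ⟨t, rfl⟩; exact ⟨t + c, rfl⟩
  · rintro ⟨t, rfl⟩; exact ⟨t - c, by simp⟩

/-- **Re-marking a Jordan domain**: two distinct frontier points `p ≠ q` of a Jordan domain are the
marked points of some Dobrushin structure on the SAME carrier (shift the boundary loop to start at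
`p`; the second mark is `fract (s_q - s_p) ∈ (0, 1)`). [folklore] -/
theorem exists_dobrushin_remark (J : JordanDomain) {p q : ℂ} (hp : p ∈ frontier J.carrier)
    (hq : q ∈ frontier J.carrier) (hpq : p ≠ q) :
    ∃ D : DobrushinDomain, D.carrier = J.carrier ∧ D.pt 0 = p ∧ D.pt 1 = q := by
  rw [J.frontier_eq_image_Ico] at hp hq
  obtain ⟨s, -, rfl⟩ := hp
  obtain ⟨s', -, rfl⟩ := hq
  set γ : ℝ → ℂ := fun t ↦ J.boundary (t + s) with hγ
  have hγp : γ.Periodic 1 := fun t ↦ by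
    simp only [hγ]
    rw [add_right_comm]
    exact J.periodic_boundary _
  let J' : JordanDomain :=
    { carrier := J.carrier
      boundary := γ
      isOpen := J.isOpen
      isBounded := J.isBounded
      isConnected := J.isConnected
      continuous_boundary := J.continuous_boundary.comp (continuous_id.add continuous_const)
      periodic_boundary := hγp
      injOn_boundary := injOn_shift' J.periodic_boundary J.injOn_boundary s
      range_boundary := by rw [hγ, range_shift', J.range_boundary] }
  set m : ℝ := Int.fract (s' - s) with hm
  have hγ0 : γ 0 = J.boundary s := by simp [hγ]
  have hγm : γ m = J.boundary s' := by
    simp only [hγ, hm, Int.fract]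
    have := J.periodic_boundary.sub_int_mul_eq (x := s') ⌊s' - s⌋
    rw [mul_one] at this
    rw [← this]
    congr 1
    ring
  have hm0 : m ≠ 0 := fun h ↦ hpq (by rw [← hγ0, ← hγm, h])
  have hmpos : 0 < m := lt_of_le_of_ne (Int.fract_nonneg _) (Ne.symm hm0)
  have hm1 : m < 1 := Int.fract_lt_one _
  refine ⟨{ toJordanDomain := J'
            mark := ![0, m]
            strictMono_mark := Fin.strictMono_iff_lt_succ.2 fun i ↦ by fin_cases i; simpa using hmpos
            mark_mem := fun i ↦ by fin_cases i <;> simp [hmpos.le, hm1] }, rfl, ?_, ?_⟩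
  · exact hγ0
  · exact hγm

/-- The marked points of `D` lie on the frontier of any hull-type subdomain `D' ⊆ D` agreeing with `D`
in a ball around them. [folklore] -/
theorem pt_mem_frontier_of_ball_agree {D D' : DobrushinDomain} (hsub : D'.carrier ⊆ D.carrier)
    {i : Fin 2} {ε : ℝ} (hε : 0 < ε)
    (hball : D'.carrier ∩ Metric.ball (D.pt i) ε = D.carrier ∩ Metric.ball (D.pt i) ε) :
    D.pt i ∈ frontier D'.carrier := by
  have hfr := D.pt_mem_frontier i
  rw [frontier_eq_closure_inter_closure] at hfr ⊢
  refine ⟨?_, closure_mono (compl_subset_compl.2 hsub) hfr.2⟩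
  -- `closure D ∩ ball ⊆ closure (ball ∩ D) = closure (ball ∩ D') ⊆ closure D'`
  have h1 : D.pt i ∈ closure (Metric.ball (D.pt i) ε ∩ D.carrier) :=
    Metric.isOpen_ball.inter_closure ⟨Metric.mem_ball_self hε, hfr.1⟩
  rw [inter_comm, ← hball] at h1
  exact closure_mono inter_subset_left h1

/-- **`hpt` is decorative**: the crux implies (hence, the converse being trivial, is equivalent to)
its variant without the marked-point clauses — re-mark `D'` at `a, b`. [folklore] -/
theorem avoidanceLimitWithoutPt_of (h : AvoidanceLimit) : AvoidanceLimitWithoutPt := by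
  intro D D' a b hab hsub hball φ hφ A hA Φ d hΦ hd
  obtain ⟨ε, hε, hb0, hb1⟩ := hball
  -- re-mark `D'` at `a = D.pt 0`, `b = D.pt 1`
  obtain ⟨D'', hcar, h0, h1⟩ := exists_dobrushin_remark D'.toJordanDomain
    (pt_mem_frontier_of_ball_agree hsub hε hb0) (pt_mem_frontier_of_ball_agree hsub hε hb1)
    (fun heq ↦ absurd (D.pt_injective heq) (by decide))
  have hcar' : D''.carrier = D'.carrier := hcar
  have := h D D'' a b hab (hcar' ▸ hsub) h0 h1 ⟨ε, hε, hcar' ▸ hb0, hcar' ▸ hb1⟩ φ hφ A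
    (by rw [hA, hcar']) Φ d hΦ hd
  rwa [hcar'] at this

end Summit.CriticalPhenomena.SAWScalingLimit.Theorems.AvoidanceLimit.Negative

end
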